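import Summits.NavierStokesRegularity.FluidComputer.RiccatiSlice
import Summits.NavierStokesRegularity.FluidComputer.HighRows
import HarnessLib

/-!
# Fluid computer — support: the ν-FREE TWO-ROW law `Y₃(t) − Y₃(s) ≤ K ∫_s^t Y₃ √Y₅` of the `Ḃ^{3/2}_{2,2}` row
# against the `Ḃ^{5/2}_{2,2}` row (McCormick–Olson–Robinson–Rodrigo–Vidal-López–Zhou 2016, (5.4) at `s = 3/2`,
# dissipation DROPPED, dyadic currency, integrated form)

HONEST FRAMING (cell `pub-fluidc`, verbatim): *low prior, high value-of-information experiment on Tao's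
machine paradigm; NOT a claim that NS blows up.* Support file of the level dictionary (successor: the WEAK
`Ḃ^{5/2}_{2,2} = Ḣ^{5/2}` clock `Besov52WeakClock`). With `a_j(τ) = ‖Δ̇_j u(τ)‖₂`, `Y₃(τ) = ∑_j 8^j a_j(τ)²`
(`≃ ‖u(τ)‖²_{Ḣ^{3/2}}`) and `Y₅(τ) = ∑_j 32^j a_j(τ)²` (`≃ ‖u(τ)‖²_{Ḣ^{5/2}}`):

* `two_row_slice_le` — ONE TIME SLICE: an absolute `K₁ > 0` such that for every `ν ≥ 0`, every smooth divergence-free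
  `L²` field `w` on `ℝ³` and every finite set of levels `I`:
  `∑_{j∈I} 8^j (−ν S_j(w) − N_j(w)) ≤ K₁ · Y₃(w) · Y₅(w)^{1/2}` — the dissipation `−ν S_j ≤ 0` is DROPPED, the transfer
  is bounded block by block by Cheskidov–Dai's low-mode ceiling (`RiccatiSlice.exists_enorm_transfer_le_local`) and
  summed by `RiccatiSummation.riccati_summation` (`≤ 2^{18} A C_B · Y₃ · Y₅^{1/2}`, Bernstein `s_l ≤ C_B 2^{3l/2} a_l`). This
  is the tree's form of `|(Λ^{3/2}B(u,u), Λ^{3/2}u)| ≤ c ‖u‖²_{Ḣ^{3/2}} ‖u‖_{Ḣ^{5/2}}` (their (5.4), `s = 3/2`), the step of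
  `RiccatiSlice.weighted_slice_le` BEFORE Young's inequality — here no viscosity is spent;
* `two_row_two_point` (**THE ν-FREE TWO-ROW LAW, integrated**) — an absolute `K > 0` such that for every `ν > 0`,
  `T > 0`, every maximal smooth solution `(u, p)` of the unforced Navier–Stokes system on `ℝ³ × [0, T)` which is
  Leray–Hopf from `u 0`, and all `0 < s ≤ t < T`:
  `Y₃(t) − Y₃(s) ≤ K ∫_s^t Y₃(τ) · Y₅(τ)^{1/2} dτ` — McCormick et al.'s `d/dt ‖u‖²_{Ḣ^{3/2}} ≤ 2c ‖u‖²_{Ḣ^{3/2}} ‖u‖_{Ḣ^{5/2}}`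
  (proof of Thm. 3.2, the dissipation discarded), obtained from the signed block balances
  (`BlockEnergyIdentity.blockL2_sq_toReal_sub_eq`) × `8^j` summed over `|j| ≤ L`, integrated (both rows are finite and
  continuous in time on interior windows, `HighRows.row_ne_top` / `HighRows.continuousOn_row`) and `L → ∞` — no infinite
  sum is differentiated. The constant involves NO viscosity and NO energy.

0 sorry; no definitions; no named facts.

## References

* D. S. McCormick, E. J. Olson, J. C. Robinson, J. L. Rodrigo, A. Vidal-López, Y. Zhou, *Lower bounds on blowing-up
  solutions of the three-dimensional Navier–Stokes equations in Ḣ^{3/2}, Ḣ^{5/2}, and Ḃ^{5/2}_{2,1}*, SIAM J. Math. Anal.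
  48 (2016) 2119–2132 = arXiv:1503.04323, (5.4) and the proof of Thm. 3.2. [MccormickEtAl2016]
* A. Cheskidov, K. Zaya, J. Math. Phys. 57 (2016) 023101 = arXiv:1503.01784, Thm. 2.2 (the summation). [CheskidovZaya2016]
* A. Cheskidov, M. Dai, Proc. Edinburgh Math. Soc. (2025) = arXiv:1507.06611, §3.1 (3.6). [CheskidovDai2015]
-/

noncomputable section

open MeasureTheory Set Function Filter Topology
open scoped ENNReal NNReal RealInnerProductSpace
open Literature.Analysis.FluidPDE Literature.Analysis.FunctionSpaces
open Summit.NavierStokesRegularity.FluidComputer.BlockEnergyTransport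
open Summit.NavierStokesRegularity.FluidComputer.BlockEnergyIdentity
open Summit.NavierStokesRegularity.FluidComputer.BlockAmplitudeCeiling (exists_blockSup_le_blockL2)
open Summit.NavierStokesRegularity.FluidComputer.RiccatiSummation
open Summit.NavierStokesRegularity.FluidComputer.RiccatiSlice

namespace Summit.NavierStokesRegularity.FluidComputer.TwoRowInequality

/-! ## One time slice -/

/-- **THE ν-FREE TWO-ROW INTEGRAND (one time slice).** There is an absolute `K₁ > 0` such that for every `ν ≥ 0`, every
smooth divergence-free `L²` field `w` on `ℝ³` and every finite set of levels `I`: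
`∑_{j∈I} 8^j (−ν S_j(w) − N_j(w)) ≤ K₁ · (∑_j 8^j ‖Δ̇_j w‖₂²) · (∑_j 32^j ‖Δ̇_j w‖₂²)^{1/2}` (real numbers; both rows of a
smooth `L²` field are finite, `RiccatiSlice.tsum_weighted_sq_ne_top`). `S_j = ∑_i ∫ |∂_i Δ̇_j w|² ≥ 0` is dropped,
`−N_j ≤ |N_j| ≤ A·(a_j ∑_{|m|≤2} a_{j+m} T_{j+m} + s_j Q_j)` (`exists_enorm_transfer_le_local`) and the `8^j`-weighted sum of
the ceilings is `≤ 2^{18} A C_B · Y₃ · Y₅^{1/2}` (`riccati_summation`, Bernstein `exists_blockSup_le_blockL2`).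
[cite: MccormickEtAl2016, (5.4) with s = 3/2] [cite: CheskidovZaya2016, Thm. 2.2 (proof)] -/
theorem two_row_slice_le :
    ∃ K₁ : ℝ, 0 < K₁ ∧ ∀ (ν : ℝ), 0 ≤ ν →
      ∀ (w : EuclideanSpace ℝ (Fin 3) → EuclideanSpace ℝ (Fin 3)), IsSmoothL2Field w → VectorCalculus.IsDivFree w →
      ∀ I : Finset ℤ,
        ∑ j ∈ I, ((2 : ℝ≥0∞) ^ ((3 : ℝ) * (j : ℝ))).toReal *
            (-ν * (∑ i, ∫ x, ‖fderiv ℝ (blockFn j w) x (stdOrthonormalBasis ℝ (EuclideanSpace ℝ (Fin 3)) i)‖ ^ 2) -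
              ∫ x, ⟪blockFn j w x, blockFn j (convect w w) x⟫) ≤
          K₁ * (∑' j : ℤ, (2 : ℝ≥0∞) ^ ((3 : ℝ) * (j : ℝ)) * blockL2 w j ^ 2).toReal *
            ((∑' j : ℤ, (2 : ℝ≥0∞) ^ ((5 : ℝ) * (j : ℝ)) * blockL2 w j ^ 2).toReal) ^ (1 / 2 : ℝ) := by
  obtain ⟨A, hAtop, hA⟩ := exists_enorm_transfer_le_local
  obtain ⟨CB, -, hB⟩ := exists_blockSup_le_blockL2
  set A' : ℝ := (2 ^ 18 * A * CB).toReal with hA'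
  refine ⟨A' + 1, by positivity, fun ν hν w hw hdiv I => ?_⟩
  -- abbreviations
  set e := stdOrthonormalBasis ℝ (EuclideanSpace ℝ (Fin 3)) with he
  set a : ℤ → ℝ≥0∞ := blockL2 w with ha
  set σ : ℤ → ℝ≥0∞ := blockSup w with hσ
  set S : ℤ → ℝ := fun j => ∑ i, ∫ x, ‖fderiv ℝ (blockFn j w) x (e i)‖ ^ 2 with hS
  set N : ℤ → ℝ := fun j => ∫ x, ⟪blockFn j w x, blockFn j (convect w w) x⟫ with hN
  set W : ℤ → ℝ≥0∞ := fun j => (2 : ℝ≥0∞) ^ ((3 : ℝ) * (j : ℝ)) with hW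
  set M : ℤ → ℝ≥0∞ := fun j => a j * ∑ m ∈ Finset.Icc (-2 : ℤ) 2, a (j + m) *
      paraT (fun l' => (2 : ℝ≥0∞) ^ l' * σ l') (j + m) + σ j * paraQ2 a (fun l => (2 : ℝ≥0∞) ^ l * a l) j with hM
  set y : ℝ≥0∞ := ∑' j : ℤ, W j * a j ^ 2 with hy
  set D : ℝ≥0∞ := ∑' j : ℤ, (2 : ℝ≥0∞) ^ ((5 : ℝ) * (j : ℝ)) * a j ^ 2 with hD
  -- finiteness
  have hytop : y ≠ ∞ := tsum_weighted_sq_ne_top hw (by norm_num) (by norm_num)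
  have hDtop : D ≠ ∞ := tsum_weighted_sq_ne_top hw (by norm_num) (by norm_num)
  have hWtop : ∀ j, W j ≠ ∞ := fun j => RiccatiSlice.two_rpow_ne_top _
  have hS0 : ∀ j, 0 ≤ S j := fun j => Finset.sum_nonneg fun i _ => integral_nonneg fun x => by positivity
  -- (i) drop the dissipation, bound `−N_j` by `|N_j|`
  have h1 : ∑ j ∈ I, (W j).toReal * (-ν * S j - N j) ≤ ∑ j ∈ I, (W j * ‖N j‖ₑ).toReal := by
    refine Finset.sum_le_sum fun j _ => ?_
    rw [ENNReal.toReal_mul, Real.enorm_eq_ofReal_abs, ENNReal.toReal_ofReal (abs_nonneg _)]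
    refine mul_le_mul_of_nonneg_left ?_ ENNReal.toReal_nonneg
    have h := hS0 j
    have hNabs : -N j ≤ |N j| := neg_le_abs _
    nlinarith
  -- (ii) the nonlinear part: `∑ W_j |N_j| ≤ 2^18 A C_B · y · D^{1/2}`
  have hB' : ∀ l : ℤ, σ l ≤ CB * (2 : ℝ≥0∞) ^ ((3 / 2 : ℝ) * (l : ℝ)) * a l := fun l => by
    rw [show (3 / 2 : ℝ) * (l : ℝ) = 3 * (l : ℝ) / 2 by ring]
    exact hB w hw.memLp_two l
  have hric := riccati_summation a σ CB hB'
  set Φ : ℝ≥0∞ := 2 ^ 18 * A * CB * y * D ^ (1 / 2 : ℝ) with hΦ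
  have hΦtop : Φ ≠ ∞ := ENNReal.mul_ne_top (ENNReal.mul_ne_top (ENNReal.mul_ne_top
    (ENNReal.mul_ne_top (by norm_num) hAtop) ENNReal.coe_ne_top) hytop)
    (ENNReal.rpow_ne_top_of_nonneg (by norm_num) hDtop)
  have hnl_enn : ∑ j ∈ I, W j * ‖N j‖ₑ ≤ Φ := by
    calc ∑ j ∈ I, W j * ‖N j‖ₑ ≤ ∑ j ∈ I, W j * (A * M j) := Finset.sum_le_sum fun j _ => by
          gcongr; exact hA w hw hdiv j
      _ = A * ∑ j ∈ I, W j * M j := by rw [Finset.mul_sum]; exact Finset.sum_congr rfl fun j _ => by ring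
      _ ≤ A * ∑' j : ℤ, W j * M j := by gcongr; exact ENNReal.sum_le_tsum I
      _ ≤ A * (2 ^ 18 * CB * y * D ^ (1 / 2 : ℝ)) := by gcongr
      _ = Φ := by rw [hΦ]; ring
  have hD0 : 0 ≤ D.toReal := ENNReal.toReal_nonneg
  have hy0 : 0 ≤ y.toReal := ENNReal.toReal_nonneg
  have hΦr : Φ.toReal = A' * y.toReal * D.toReal ^ (1 / 2 : ℝ) := by
    rw [hΦ, hA', ENNReal.toReal_mul, ENNReal.toReal_mul, ENNReal.toReal_rpow]
  have h2 : ∑ j ∈ I, (W j * ‖N j‖ₑ).toReal ≤ A' * y.toReal * D.toReal ^ (1 / 2 : ℝ) := by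
    calc ∑ j ∈ I, (W j * ‖N j‖ₑ).toReal = (∑ j ∈ I, W j * ‖N j‖ₑ).toReal :=
          (ENNReal.toReal_sum fun j _ => ENNReal.mul_ne_top (hWtop j) enorm_ne_top).symm
      _ ≤ Φ.toReal := ENNReal.toReal_mono hΦtop hnl_enn
      _ = A' * y.toReal * D.toReal ^ (1 / 2 : ℝ) := hΦr
  have h3 : A' * y.toReal * D.toReal ^ (1 / 2 : ℝ) ≤ (A' + 1) * y.toReal * D.toReal ^ (1 / 2 : ℝ) := by
    have : 0 ≤ y.toReal * D.toReal ^ (1 / 2 : ℝ) := by positivity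
    nlinarith
  calc ∑ j ∈ I, (W j).toReal * (-ν * S j - N j) ≤ ∑ j ∈ I, (W j * ‖N j‖ₑ).toReal := h1
    _ ≤ A' * y.toReal * D.toReal ^ (1 / 2 : ℝ) := h2
    _ ≤ (A' + 1) * y.toReal * D.toReal ^ (1 / 2 : ℝ) := h3

/-! ## The integrated ν-free two-row law -/

/-- **THE ν-FREE TWO-ROW LAW, integrated (McCormick–Olson–Robinson–Rodrigo–Vidal-López–Zhou 2016, proof of Thm. 3.2,
dyadic currency).** There is an absolute `K > 0` such that for every `ν > 0`, `T > 0`, every maximal smooth solution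
`(u, p)` of the unforced Navier–Stokes system on `ℝ³ × [0, T)` which is Leray–Hopf from `u 0`, and all `0 < s ≤ t < T`:
`Y₃(t) − Y₃(s) ≤ K ∫_s^t Y₃(τ) · Y₅(τ)^{1/2} dτ`, `Y₃(τ) = ∑_j 8^j ‖Δ̇_j u(τ)‖₂²`, `Y₅(τ) = ∑_j 32^j ‖Δ̇_j u(τ)‖₂²` — their
`d/dt ‖u‖²_{Ḣ^{3/2}} ≤ 2c_{3/2} ‖u‖²_{Ḣ^{3/2}} ‖u‖_{Ḣ^{5/2}}` with the dissipation discarded; NO viscosity and NO energy in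
`K`. Proof: the signed block balances (`blockL2_sq_toReal_sub_eq`) × `8^j` summed over `|j| ≤ L`, `two_row_slice_le` on
each slice, integration in time (both rows continuous on `[s, t]`, `HighRows.continuousOn_row`), `L → ∞`.
[cite: MccormickEtAl2016, proof of Thm. 3.2] [cite: CheskidovZaya2016, Thm. 2.2] -/
theorem two_row_two_point :
    ∃ K : ℝ, 0 < K ∧ ∀ (ν T : ℝ), 0 < ν → 0 < T →
      ∀ (u : ℝ → EuclideanSpace ℝ (Fin 3) → EuclideanSpace ℝ (Fin 3)) (p : ℝ → EuclideanSpace ℝ (Fin 3) → ℝ),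
      IsMaximalSmoothSolution ν 0 u p T → IsLerayHopfOn T ν 0 (u 0) u →
      ∀ s t : ℝ, 0 < s → s ≤ t → t < T →
        (∑' j : ℤ, (2 : ℝ≥0∞) ^ ((3 : ℝ) * (j : ℝ)) * blockL2 (u t) j ^ 2).toReal -
            (∑' j : ℤ, (2 : ℝ≥0∞) ^ ((3 : ℝ) * (j : ℝ)) * blockL2 (u s) j ^ 2).toReal ≤
          K * ∫ τ in s..t, (∑' j : ℤ, (2 : ℝ≥0∞) ^ ((3 : ℝ) * (j : ℝ)) * blockL2 (u τ) j ^ 2).toReal *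
            ((∑' j : ℤ, (2 : ℝ≥0∞) ^ ((5 : ℝ) * (j : ℝ)) * blockL2 (u τ) j ^ 2).toReal) ^ (1 / 2 : ℝ) := by
  obtain ⟨K₁, hK₁, hslice⟩ := two_row_slice_le
  refine ⟨2 * K₁, by positivity, fun ν T hν hT u p hmax hLH s t hs hst htT => ?_⟩
  set W : ℤ → ℝ≥0∞ := fun j => (2 : ℝ≥0∞) ^ ((3 : ℝ) * (j : ℝ)) with hW
  set W₅ : ℤ → ℝ≥0∞ := fun j => (2 : ℝ≥0∞) ^ ((5 : ℝ) * (j : ℝ)) with hW₅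
  set Y : ℝ → ℝ := fun τ => (∑' j : ℤ, W j * blockL2 (u τ) j ^ 2).toReal with hY
  set D : ℝ → ℝ := fun τ => (∑' j : ℤ, W₅ j * blockL2 (u τ) j ^ 2).toReal with hD
  set F : ℕ → ℝ → ℝ := fun L τ =>
    ∑ j ∈ Finset.Icc (-(L : ℤ)) L, (W j).toReal * (blockL2 (u τ) j ^ 2).toReal with hF
  set g : ℤ → ℝ → ℝ := fun j τ =>
    -ν * (∑ i, ∫ x, ‖fderiv ℝ (blockFn j (u τ)) x (stdOrthonormalBasis ℝ (EuclideanSpace ℝ (Fin 3)) i)‖ ^ 2) -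
      ∫ x, ⟪blockFn j (u τ) x, blockFn j (convect (u τ) (u τ)) x⟫ with hg
  have hsub : Icc s t ⊆ Ioo 0 T := fun τ hτ => ⟨hs.trans_le hτ.1, hτ.2.trans_lt htT⟩
  have hw : ∀ τ ∈ Icc s t, IsSmoothL2Field (u τ) := fun τ hτ =>
    isSmoothL2Field_slice_of_maximal hν hT hmax hLH (hsub hτ)
  have hdiv : ∀ τ ∈ Icc s t, VectorCalculus.IsDivFree (u τ) := fun τ hτ =>
    hmax.1.divFree τ ⟨(hsub hτ).1.le, (hsub hτ).2⟩
  have hWtop : ∀ j, W j ≠ ∞ := fun j => RiccatiSlice.two_rpow_ne_top _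
  have haj : ∀ τ ∈ Icc s t, ∀ j, blockL2 (u τ) j ^ 2 ≠ ∞ := fun τ hτ j =>
    ENNReal.pow_ne_top (((hw τ hτ).blockFn j).memLp_two).eLpNorm_ne_top
  have hytop : ∀ τ ∈ Icc s t, ∑' j : ℤ, W j * blockL2 (u τ) j ^ 2 ≠ ∞ := fun τ hτ =>
    tsum_weighted_sq_ne_top (hw τ hτ) (by norm_num) (by norm_num)
  have hYc : ContinuousOn Y (Icc s t) :=
    HighRows.continuousOn_row (κ := 3) (by norm_num) hν hT hmax hLH hs hst htT
  have hDc : ContinuousOn D (Icc s t) :=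
    HighRows.continuousOn_row (κ := 5) (by norm_num) hν hT hmax hLH hs hst htT
  have hY0 : ∀ τ, 0 ≤ Y τ := fun τ => ENNReal.toReal_nonneg
  have hD0 : ∀ τ, 0 ≤ D τ := fun τ => ENNReal.toReal_nonneg
  have hYDc : ContinuousOn (fun τ => Y τ * D τ ^ (1 / 2 : ℝ)) (Icc s t) :=
    hYc.mul (hDc.rpow_const fun τ _ => Or.inr (by norm_num))
  have hYD : IntervalIntegrable (fun τ => Y τ * D τ ^ (1 / 2 : ℝ)) volume s t := by
    refine ContinuousOn.intervalIntegrable ?_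
    rw [uIcc_of_le hst]
    exact hYDc
  -- the block balances and their integrability
  have hgint : ∀ j, IntervalIntegrable (g j) volume s t := fun j => by
    obtain ⟨hN, hS, -⟩ := blockL2_sq_toReal_sub_eq hν hT hmax hLH hs hst htT j
    exact (hS.const_mul (-ν)).sub hN
  have hEq : ∀ j, (blockL2 (u t) j ^ 2).toReal - (blockL2 (u s) j ^ 2).toReal = 2 * ∫ τ in s..t, g j τ := fun j =>
    (blockL2_sq_toReal_sub_eq hν hT hmax hLH hs hst htT j).2.2
  -- Step 1: the inequality at level `L`
  have hL : ∀ L : ℕ, F L t - F L s ≤ 2 * (K₁ * ∫ τ in s..t, Y τ * D τ ^ (1 / 2 : ℝ)) := by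
    intro L
    set I : Finset ℤ := Finset.Icc (-(L : ℤ)) L with hI
    have hid : F L t - F L s = 2 * ∫ τ in s..t, ∑ j ∈ I, (W j).toReal * g j τ := by
      show (∑ j ∈ I, (W j).toReal * (blockL2 (u t) j ^ 2).toReal) -
          ∑ j ∈ I, (W j).toReal * (blockL2 (u s) j ^ 2).toReal = _
      rw [← Finset.sum_sub_distrib, intervalIntegral.integral_finsetSum fun j _ => (hgint j).const_mul _,
        Finset.mul_sum]
      refine Finset.sum_congr rfl fun j _ => ?_
      rw [← mul_sub, hEq j, intervalIntegral.integral_const_mul]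
      ring
    have hint : IntervalIntegrable (fun τ => ∑ j ∈ I, (W j).toReal * g j τ) volume s t :=
      (IntervalIntegrable.sum I fun j _ => (hgint j).const_mul ((W j).toReal)).congr fun τ _ => by
        simp only [Finset.sum_apply]
    have hint' : IntervalIntegrable (fun τ => K₁ * (Y τ * D τ ^ (1 / 2 : ℝ))) volume s t := hYD.const_mul _
    have hbound : ∀ τ ∈ Icc s t, ∑ j ∈ I, (W j).toReal * g j τ ≤ K₁ * (Y τ * D τ ^ (1 / 2 : ℝ)) := by
      intro τ hτ
      have h := hslice ν hν.le (u τ) (hw τ hτ) (hdiv τ hτ) I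
      rw [mul_assoc] at h
      exact h
    have hmono := intervalIntegral.integral_mono_on hst hint hint' hbound
    rw [hid]
    rw [intervalIntegral.integral_const_mul] at hmono
    linarith
  -- Step 2: `L → ∞`
  have hlimF : ∀ τ ∈ Icc s t, Tendsto (fun L : ℕ => F L τ) atTop (𝓝 (Y τ)) := by
    intro τ hτ
    have h1 : ∀ L : ℕ, F L τ = (∑ j ∈ Finset.Icc (-(L : ℤ)) L, W j * blockL2 (u τ) j ^ 2).toReal := by
      intro L
      rw [ENNReal.toReal_sum fun j _ => ENNReal.mul_ne_top (hWtop j) (haj τ hτ j)]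
      exact Finset.sum_congr rfl fun j _ => (ENNReal.toReal_mul).symm
    simp_rw [h1]
    exact (ENNReal.tendsto_toReal (hytop τ hτ)).comp (tendsto_sum_Icc_atTop _)
  have hlim := le_of_tendsto_of_tendsto ((hlimF t ⟨hst, le_rfl⟩).sub (hlimF s ⟨le_rfl, hst⟩))
    tendsto_const_nhds (Eventually.of_forall hL)
  have e : 2 * (K₁ * ∫ τ in s..t, Y τ * D τ ^ (1 / 2 : ℝ)) = 2 * K₁ * ∫ τ in s..t, Y τ * D τ ^ (1 / 2 : ℝ) := by ring
  exact hlim.trans_eq e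

end Summit.NavierStokesRegularity.FluidComputer.TwoRowInequality

end
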